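import Summits.ValiantsHypothesis.ValiantsHypothesis.Theorems.LacunarySymmetroidMatrixDescartesFiniteSectorSieveCapTwentytwoFiveWitness

/-!
# `MatrixDescartes` — line «finite»: bits ⇒ sums (converse of the mask lemma) and the (22,5) sieve chain in SUM-SET currency

HONEST FRAMING.  Object-search cell `pub-symmetroid`, seat val-sym-door-p5 g13.  HELPER of the crux item `stmt-ValiantsHypothesis-18050`
(`Theses.LacunarySymmetroid.MatrixDescartes`) with NO closure claim and no statement about pencils.  (1) The CONVERSE of
`testBit_iterMask_of_multiset'` (`…FiniteSectorIterMasks`, seat g11): a set bit `r` of the `m`-th iterated shift-or mask of a value list `l` IS an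
`m`-fold sum of values of `l` (`exists_multiset_of_testBit_iterMask`), and an `m`-fold sum of values of `d : Fin K → ℕ` lies in the census sum set
`image (fun s : Sym (Fin K) m => (s.map d).sum) univ` — the currency of `FiniteSector.sieve` / `natDegree_mem_sumset` (`sum_mem_sumset_of_multiset`).
(2) With the kernel bit facts of `…SieveCapTwentytwoFiveWitness` this puts the located finding of this seat (evidence #50 on the item) in the sieve's own
currency: on the MIXED-PARITY support `E* = (0,2,35,224,1283)` the degree `n = 8783` satisfies EVERY constraint the sieve places on an in-sector `22 × 22`
pencil — `n ∈ 22·E*` and, for every `r + 2 ≤ n`, `r ∈ 22·E*` or `r + 1 ∈ 22·E*` (`sieveChain_twentytwo_five`) — whereas `2·n(22,4) = 8736`; so the sieve cap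
`σ(22,5)` is `≥ 8783 > 2·n(22,4)`: Conjecture Σ of `Cruxes/MatrixDescartes/Lines/finite.md` FAILS at `(22,5)` (the upper side `σ(22,5) ≤ 8783` is the cell
`…SectorCeilingTwentytwoFive`).  NOT CLAIMED: any `η` lower side (realisability of degree `> 8736` on `E*` by an actual symmetric pencil is open),
anything asymptotic, anything about the doors or `VP ≠ VNP`.
[folklore] Elementary bit arithmetic and multiset bookkeeping; no citation is load-bearing.
-/

-- `Summit.ValiantsHypothesis.ValiantsHypothesis.…` repeats a component by the D-0017 layout
-- (single-conjunct summit), which the `dupNamespace` linter flags; the name is mandated.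
set_option linter.dupNamespace false

namespace Summit.ValiantsHypothesis.ValiantsHypothesis.Theorems.LacunarySymmetroidMatrixDescartes.FiniteSector

/-! ## Bits ⇒ sums -/

/-- One shift-or step, converse: a set bit `r` of `List.rec 0 (fun x _ acc => acc ||| (E <<< x)) l` comes from some `x ∈ l` with `x ≤ r` and bit
`r - x` of `E` set. [folklore] -/
theorem exists_mem_of_testBit_shiftStep {l : List ℕ} {E r : ℕ}
    (h : (@List.rec ℕ (fun _ => ℕ) 0 (fun (x : ℕ) (_ : List ℕ) (acc : ℕ) => Nat.lor acc (Nat.shiftLeft E x)) l).testBit r = true) :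
    ∃ x ∈ l, x ≤ r ∧ E.testBit (r - x) = true := by
  induction l with
  | nil => simp at h
  | cons y l ih =>
    change (Nat.lor (@List.rec ℕ (fun _ => ℕ) 0 (fun (x : ℕ) (_ : List ℕ) (acc : ℕ) => Nat.lor acc (Nat.shiftLeft E x)) l)
      (Nat.shiftLeft E y)).testBit r = true at h
    have e1 : ∀ a b : ℕ, Nat.lor a b = a ||| b := fun _ _ => rfl
    have e2 : ∀ a b : ℕ, Nat.shiftLeft a b = a <<< b := fun _ _ => rfl
    rw [e1, e2, Nat.testBit_lor, Bool.or_eq_true] at h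
    rcases h with h | h
    · obtain ⟨x, hx, hxr, hE⟩ := ih h
      exact ⟨x, List.mem_cons_of_mem _ hx, hxr, hE⟩
    · rw [Nat.testBit_shiftLeft] at h
      simp only [ge_iff_le, Bool.and_eq_true, decide_eq_true_eq] at h
      exact ⟨y, List.mem_cons_self, h.1, h.2⟩

/-- **Bit ⇒ sum, iterated form** (converse of `testBit_iterMask_of_multiset'`): a set bit `r` of the `m`-th iterate `(F l)^[m] 1` of the shift-or
step is the sum of a multiset of `m` elements of `l`. [folklore] -/
theorem exists_multiset_of_testBit_iterMask (l : List ℕ) :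
    ∀ (m r : ℕ), ((fun (E : ℕ) => @List.rec ℕ (fun _ => ℕ) 0 (fun (x : ℕ) (_ : List ℕ) (acc : ℕ) => Nat.lor acc (Nat.shiftLeft E x)) l)^[m] 1).testBit
      r = true → ∃ t : Multiset ℕ, (∀ x ∈ t, x ∈ l) ∧ Multiset.card t = m ∧ t.sum = r := by
  intro m
  induction m with
  | zero =>
    intro r h
    rw [Function.iterate_zero, id_eq, Nat.testBit_one_eq_true_iff_self_eq_zero] at h
    exact ⟨0, by simp, rfl, by simp [h]⟩
  | succ m ih =>
    intro r h
    rw [Function.iterate_succ_apply'] at h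
    obtain ⟨x, hx, hxr, hE⟩ := exists_mem_of_testBit_shiftStep h
    obtain ⟨t, ht, hcard, hsum⟩ := ih (r - x) hE
    refine ⟨x ::ₘ t, ?_, by rw [Multiset.card_cons, hcard], ?_⟩
    · intro z hz
      rcases Multiset.mem_cons.mp hz with rfl | hz
      · exact hx
      · exact ht z hz
    · rw [Multiset.sum_cons, hsum]; omega

/-- An `m`-fold sum of values of `d : Fin K → ℕ` lies in the census `m`-fold sum set of `d` (the currency of `FiniteSector.sieve`). [folklore] -/
theorem sum_mem_sumset_of_multiset {K : ℕ} (d : Fin K → ℕ) (t : Multiset ℕ) (ht : ∀ x ∈ t, ∃ i, d i = x) (m : ℕ)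
    (hm : Multiset.card t = m) :
    t.sum ∈ (Finset.univ : Finset (Sym (Fin K) m)).image (fun s : Sym (Fin K) m => ((s : Multiset (Fin K)).map d).sum) := by
  have key : ∀ u : Multiset ℕ, (∀ x ∈ u, ∃ i, d i = x) → ∃ s : Multiset (Fin K), s.map d = u := by
    intro u
    induction u using Multiset.induction_on with
    | empty => intro _; exact ⟨0, by simp⟩
    | cons y u ih =>
      intro hu
      obtain ⟨i, hi⟩ := hu y (Multiset.mem_cons_self _ _)
      obtain ⟨s, hs⟩ := ih fun x hx => hu x (Multiset.mem_cons_of_mem hx)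
      exact ⟨i ::ₘ s, by rw [Multiset.map_cons, hi, hs]⟩
  obtain ⟨s, hs⟩ := key t ht
  have hcard : Multiset.card s = m := by rw [← hm, ← hs, Multiset.card_map]
  refine Finset.mem_image.mpr ⟨Sym.mk s hcard, Finset.mem_univ _, ?_⟩
  change (s.map d).sum = t.sum
  rw [hs]

/-- Bits ⇒ sum-set membership, for a value list that enumerates `d`. [folklore] -/
theorem mem_sumset_of_testBit_iterMask {K : ℕ} (d : Fin K → ℕ) (l : List ℕ) (hl : ∀ x ∈ l, ∃ i, d i = x) (m r : ℕ)
    (h : ((fun (E : ℕ) => @List.rec ℕ (fun _ => ℕ) 0 (fun (x : ℕ) (_ : List ℕ) (acc : ℕ) => Nat.lor acc (Nat.shiftLeft E x)) l)^[m] 1).testBit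
      r = true) :
    r ∈ (Finset.univ : Finset (Sym (Fin K) m)).image (fun s : Sym (Fin K) m => ((s : Multiset (Fin K)).map d).sum) := by
  obtain ⟨t, ht, hcard, hsum⟩ := exists_multiset_of_testBit_iterMask l m r h
  rw [← hsum]
  exact sum_mem_sumset_of_multiset d t (fun x hx => hl x (ht x hx)) m hcard

/-! ## The `(22,5)` sieve chain on `E* = (0,2,35,224,1283)` in sum-set currency -/

/-- **Conjecture Σ fails at `(22,5)`, sum-set form.**  On the mixed-parity support `E* = (0, 2, 35, 224, 1283)` the degree `n = 8783` meets every
constraint of the SIEVE for `22 × 22` pencils: `8783` is a `22`-fold sum of exponents (`natDegree_mem_sumset` shape) and of any two consecutive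
`r, r + 1` with `r + 2 ≤ 8783` at least one is a `22`-fold sum (`sieve` shape).  Since `2·n(22,4) = 8736 < 8783`, the sieve cap `σ(22,5)` exceeds
Conjecture Σ's value; the matching upper side `HypRootLawAt 22 5 8783` is `…SectorCeilingTwentytwoFive`.  No `η` lower side is claimed. [folklore] -/
theorem sieveChain_twentytwo_five :
    8783 ∈ (Finset.univ : Finset (Sym (Fin 5) 22)).image
        (fun s : Sym (Fin 5) 22 => ((s : Multiset (Fin 5)).map (![0, 2, 35, 224, 1283] : Fin 5 → ℕ)).sum) ∧
      ∀ r, r + 2 ≤ 8783 →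
        r ∈ (Finset.univ : Finset (Sym (Fin 5) 22)).image
            (fun s : Sym (Fin 5) 22 => ((s : Multiset (Fin 5)).map (![0, 2, 35, 224, 1283] : Fin 5 → ℕ)).sum) ∨
          r + 1 ∈ (Finset.univ : Finset (Sym (Fin 5) 22)).image
            (fun s : Sym (Fin 5) 22 => ((s : Multiset (Fin 5)).map (![0, 2, 35, 224, 1283] : Fin 5 → ℕ)).sum) := by
  have hl : ∀ x ∈ ([0, 2, 35, 224, 1283] : List ℕ), ∃ i, (![0, 2, 35, 224, 1283] : Fin 5 → ℕ) i = x := by decide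
  refine ⟨mem_sumset_of_testBit_iterMask _ _ hl 22 8783 sieveWitness_twentytwo_five_top, fun r hr => ?_⟩
  rcases sieveWitness_twentytwo_five_alive r (by omega) with h | h
  · exact Or.inl (mem_sumset_of_testBit_iterMask _ _ hl 22 r h)
  · exact Or.inr (mem_sumset_of_testBit_iterMask _ _ hl 22 (r + 1) h)

end Summit.ValiantsHypothesis.ValiantsHypothesis.Theorems.LacunarySymmetroidMatrixDescartes.FiniteSector
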